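import Summits.Ventures.Crystal3D.Theorems.StickyWulffConstantCoaxialWallLawEndRowDefs
import HarnessLib

/-!
# RE-TYPING CANDIDATE for lane F's census rows: the FRACTIONAL-ASSIGNMENT (LP / Hall) form and its discharge

HONEST FRAMING. Venture `Summits/Ventures/Crystal3D` (cell `crystal3d-full`), helper `--supports` the crux `CoaxialWallLaw`
(stmt-Ventures-19481, `route-Ventures-StickyWulffConstant`, REGISTERED line `WallLedgerF`, open stub `stub_coaxialTwoSlabAdhesion`).
CONTEXT (seat 19481-p1 gen 12): the typed row `LocalEndRow` (`…EndRowDefs`: deficiency-PROPORTIONAL pooling at radius `1`) is refuted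
at the law's threshold for translation pairs (`not_endRowTrans_v1_two_sqrt_six`, `…EndRowTransRefutation`), while the LP-OPTIMAL
radius-`1` discharge constant of every adversarial witness found is `≤ 3.5 < 2√6` (memo HOME/wall-19481-p1/g12/F-ADVROW-g12.md
§2.6): the loss is the proportional rule, not the locality.  THIS FILE states the weakest radius-`1` local census object — the
EXISTENCE of a fractional assignment of end multiplicities to payers with load at most `s_F` per unit deficiency — and proves the
same global consequence as `…EndRowDischarge.card_endPairs_le_of_localRow`.  DEFINITIONS + book-keeping only; a CANDIDATE for the
planner (cf-p1) and the owner of the cell theorems (19481-p2) — nothing here is adopted by the route, and no census value is claimed.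

* `LocalEndRowLP v sF S₁ S₂` — for every finite `1`-separated `X` there is `f : E³ → E³ → ℝ≥0`, supported on pairs `(b, z)` with
  `z ∈ X` a payer (`deg z ≤ 11`) at distance `≤ 1` from `b`, with SUPPLY `endMult b ≤ Σ_z f b z` at every `b ∈ X` and LOAD
  `Σ_b f b z ≤ sF · (12 − deg z)` at every payer `z`;
* `EndRowTransLP v sF`, `EndRowTwinHalfTurnLP v sF` — the corresponding census Props (same plate systems as `EndRowTrans` /
  `EndRowTwinHalfTurn`);
* `localEndRowLP_of_localEndRow` — the typed proportional row IMPLIES the LP row (the proportional split is one assignment), so the LP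
  Props are WEAKER hypotheses;
* `card_endPairs_le_of_LP` — LOCAL ⇒ GLOBAL exactly as in `…EndRowDischarge`: `#T ≤ sF · Σ_{z ∈ PAYW} (12 − deg z)` for every exported
  end-pair set `T` whose fibres are bounded by `endMult` (`hTle`), under the same window hypotheses `hT / hPAYW / hclosed`.
WHAT THIS IS NOT: not adopted by the route; no certificate; F-C1 not moved.
-/

noncomputable section

namespace Summit.Ventures.Crystal3D.Theorems

open Summit.Ventures.Crystal3D Finset
open scoped InnerProductSpace

open scoped Classical in
/-- **LP form of the pooled end row** (re-typing candidate): a fractional assignment of end multiplicities to payers within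
distance `1`, with load at most `sF` per unit of deficiency. -/
def LocalEndRowLP (v : WordVersion) (sF : ℝ) (S₁ S₂ : PlateSystem) : Prop :=
  ∀ (X : Finset (EuclideanSpace ℝ (Fin 3))), (∀ p ∈ X, ∀ q ∈ X, p ≠ q → 1 ≤ dist p q) →
    ∃ f : EuclideanSpace ℝ (Fin 3) → EuclideanSpace ℝ (Fin 3) → ℝ,
      (∀ b z, 0 ≤ f b z) ∧
      (∀ b z, f b z ≠ 0 → z ∈ X ∧ dist b z ≤ 1 ∧ (X.filter fun q => dist z q = 1).card ≤ 11) ∧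
      (∀ b ∈ X, (endMult X v S₁ S₂ b : ℝ) ≤
        ∑ z ∈ X.filter (fun z => dist b z ≤ 1 ∧ (X.filter fun q => dist z q = 1).card ≤ 11), f b z) ∧
      (∀ z ∈ X, (X.filter fun q => dist z q = 1).card ≤ 11 →
        ∑ b ∈ X.filter (fun b => dist z b ≤ 1), f b z ≤ sF * ((12 : ℝ) - ((X.filter fun q => dist z q = 1).card : ℝ)))

/-- **LP census Prop (translation pairs)**: same plate systems as `EndRowTrans`. -/
def EndRowTransLP (v : WordVersion) (sF : ℝ) : Prop :=
  ∀ L : EuclideanSpace ℝ (Fin 3) ≃ₗᵢ[ℝ] EuclideanSpace ℝ (Fin 3),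
    LocalEndRowLP v sF ⟨L, inPlaneRoots L 1⟩ ⟨L, inPlaneRoots L (-1)⟩

/-- **LP census Prop (twins, half-turn form)**: same plate systems as `EndRowTwinHalfTurn`. -/
def EndRowTwinHalfTurnLP (v : WordVersion) (sF : ℝ) : Prop :=
  ∀ L : EuclideanSpace ℝ (Fin 3) ≃ₗᵢ[ℝ] EuclideanSpace ℝ (Fin 3),
    LocalEndRowLP v sF ⟨L, inPlaneRoots L 1⟩
      ⟨((ℝ ∙ EuclideanSpace.single (2 : Fin 3) (1 : ℝ)).reflection).trans L,
        inPlaneRoots (((ℝ ∙ EuclideanSpace.single (2 : Fin 3) (1 : ℝ)).reflection).trans L) (-1)⟩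

open scoped Classical in
/-- **The proportional row implies the LP row** (the proportional split is a feasible assignment). -/
theorem localEndRowLP_of_localEndRow {v : WordVersion} {sF : ℝ} {S₁ S₂ : PlateSystem} (h : LocalEndRow v sF S₁ S₂) :
    LocalEndRowLP v sF S₁ S₂ := by
  intro X hX
  set deg : EuclideanSpace ℝ (Fin 3) → ℕ := fun z => (X.filter fun q => dist z q = 1).card with hdeg
  set df : EuclideanSpace ℝ (Fin 3) → ℝ := fun z => (12 : ℝ) - (deg z : ℝ) with hdf
  set N : EuclideanSpace ℝ (Fin 3) → Finset (EuclideanSpace ℝ (Fin 3)) :=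
    fun b => X.filter (fun z' => dist b z' ≤ 1 ∧ deg z' ≤ 11) with hN
  set D : EuclideanSpace ℝ (Fin 3) → ℝ := fun b => ∑ z' ∈ N b, df z' with hD
  have hdf0 : ∀ z, deg z ≤ 11 → 0 ≤ df z := by
    intro z hz; have : (deg z : ℝ) ≤ 11 := by exact_mod_cast hz
    show (0 : ℝ) ≤ 12 - (deg z : ℝ); linarith
  have hD0 : ∀ b, 0 ≤ D b := fun b => sum_nonneg fun z hz => hdf0 z (mem_filter.1 hz).2.2
  have hDpool : ∀ b, pooledDef X b = D b := fun b => rfl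
  -- the proportional assignment
  set fa : EuclideanSpace ℝ (Fin 3) → EuclideanSpace ℝ (Fin 3) → ℝ :=
    fun b z => if z ∈ N b then (endMult X v S₁ S₂ b : ℝ) * df z / D b else 0 with hfa
  have key : ∀ b z, fa b z = if z ∈ N b then (endMult X v S₁ S₂ b : ℝ) * df z / D b else 0 := fun _ _ => rfl
  refine ⟨fa, ?_, ?_, ?_, ?_⟩
  · intro b z
    rw [key]
    split_ifs with hz
    · exact div_nonneg (mul_nonneg (Nat.cast_nonneg _) (hdf0 z (mem_filter.1 hz).2.2)) (hD0 b)
    · exact le_rfl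
  · intro b z hbz
    rw [key] at hbz
    by_cases hz : z ∈ N b
    · obtain ⟨hzX, hd, hz11⟩ := mem_filter.1 hz
      exact ⟨hzX, hd, hz11⟩
    · exact absurd (if_neg hz) hbz
  · intro b hb
    simp only [key]
    by_cases h0 : endMult X v S₁ S₂ b = 0
    · rw [h0, Nat.cast_zero]
      exact sum_nonneg fun z hz => by
        rw [if_pos hz]; exact div_nonneg (mul_nonneg le_rfl (hdf0 z (mem_filter.1 hz).2.2)) (hD0 b)
    · -- positive end multiplicity ⇒ the pool is positive (an end pair has two payers, one within distance 1)
      have hpos : 0 < D b := by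
        obtain ⟨q, hq⟩ := card_pos.1 (Nat.pos_of_ne_zero h0)
        rw [mem_filter] at hq
        obtain ⟨-, -, hbX, htwo, -⟩ := hq
        rcases htwo with hb11 | ⟨z₁, hz₁, z₂, -, -, hd₁, -, hz₁11, -⟩
        · have hbN : b ∈ N b := mem_filter.2 ⟨hbX, by simp, hb11⟩
          calc (0 : ℝ) < df b := by
                have : (deg b : ℝ) ≤ 11 := by exact_mod_cast hb11
                show (0 : ℝ) < 12 - (deg b : ℝ); linarith
            _ ≤ D b := single_le_sum (fun z hz => hdf0 z (mem_filter.1 hz).2.2) hbN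
        · have hzN : z₁ ∈ N b := mem_filter.2 ⟨hz₁, le_of_eq hd₁, hz₁11⟩
          calc (0 : ℝ) < df z₁ := by
                have : (deg z₁ : ℝ) ≤ 11 := by exact_mod_cast hz₁11
                show (0 : ℝ) < 12 - (deg z₁ : ℝ); linarith
            _ ≤ D b := single_le_sum (fun z hz => hdf0 z (mem_filter.1 hz).2.2) hzN
      have e : ∑ z ∈ N b, (if z ∈ N b then (endMult X v S₁ S₂ b : ℝ) * df z / D b else 0) =
          (endMult X v S₁ S₂ b : ℝ) / D b * ∑ z ∈ N b, df z := by
        rw [mul_sum]; refine sum_congr rfl fun z hz => ?_; rw [if_pos hz]; ring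
      rw [e]
      show (endMult X v S₁ S₂ b : ℝ) ≤ (endMult X v S₁ S₂ b : ℝ) / D b * D b
      rw [div_mul_cancel₀ _ hpos.ne']
  · intro z hzX hz11
    have hrow := h X hX z hzX hz11
    simp only [key]
    -- restrict the load sum to end balls and compare with the row at `z`
    have e : ∑ b ∈ X.filter (fun b => dist z b ≤ 1), (if z ∈ N b then (endMult X v S₁ S₂ b : ℝ) * df z / D b else 0) =
        ∑ b ∈ X.filter (fun b => dist z b ≤ 1 ∧ 0 < endMult X v S₁ S₂ b),
          df z * ((endMult X v S₁ S₂ b : ℝ) / pooledDef X b) := by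
      symm
      have step : ∑ b ∈ X.filter (fun b => dist z b ≤ 1 ∧ 0 < endMult X v S₁ S₂ b),
            (if z ∈ N b then (endMult X v S₁ S₂ b : ℝ) * df z / D b else 0) =
          ∑ b ∈ X.filter (fun b => dist z b ≤ 1), (if z ∈ N b then (endMult X v S₁ S₂ b : ℝ) * df z / D b else 0) := by
        refine sum_subset (fun b hb => ?_) (fun b hb hnb => ?_)
        · obtain ⟨hbX, hd, -⟩ := mem_filter.1 hb; exact mem_filter.2 ⟨hbX, hd⟩
        · obtain ⟨hbX, hd⟩ := mem_filter.1 hb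
          have h0 : endMult X v S₁ S₂ b = 0 := by
            by_contra h0; exact hnb (mem_filter.2 ⟨hbX, hd, Nat.pos_of_ne_zero h0⟩)
          rw [h0]; simp
      rw [← step]
      refine sum_congr rfl fun b hb => ?_
      obtain ⟨hbX, hd, -⟩ := mem_filter.1 hb
      have hzN : z ∈ N b := mem_filter.2 ⟨hzX, by rw [dist_comm]; exact hd, hz11⟩
      rw [if_pos hzN, hDpool]; ring
    rw [e, ← mul_sum, mul_comm]
    exact mul_le_mul_of_nonneg_right hrow (hdf0 z hz11)

open scoped Classical in
/-- **LP row ⇒ global end-pair bound** (the analogue of `card_endPairs_le_of_localRow`).  `T` = exported (end ball, predecessor)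
pairs with fibres bounded by the end multiplicity (`hTle`); window hypotheses as there. -/
theorem card_endPairs_le_of_LP {X : Finset (EuclideanSpace ℝ (Fin 3))} {v : WordVersion} {S₁ S₂ : PlateSystem}
    (T : Finset (EuclideanSpace ℝ (Fin 3) × EuclideanSpace ℝ (Fin 3)))
    (PAYW : Finset (EuclideanSpace ℝ (Fin 3))) {sF : ℝ}
    (hT : ∀ bq ∈ T, bq.1 ∈ X)
    (hTle : ∀ b ∈ X, (T.filter fun bq => bq.1 = b).card ≤ endMult X v S₁ S₂ b)
    (hPAYW : ∀ z ∈ PAYW, z ∈ X ∧ (X.filter fun q => dist z q = 1).card ≤ 11)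
    (hclosed : ∀ bq ∈ T, ∀ z ∈ X, dist bq.1 z ≤ 1 → (X.filter fun q => dist z q = 1).card ≤ 11 → z ∈ PAYW)
    {f : EuclideanSpace ℝ (Fin 3) → EuclideanSpace ℝ (Fin 3) → ℝ}
    (hf0 : ∀ b z, 0 ≤ f b z)
    (hsupply : ∀ b ∈ X, (endMult X v S₁ S₂ b : ℝ) ≤
        ∑ z ∈ X.filter (fun z => dist b z ≤ 1 ∧ (X.filter fun q => dist z q = 1).card ≤ 11), f b z)
    (hload : ∀ z ∈ X, (X.filter fun q => dist z q = 1).card ≤ 11 →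
        ∑ b ∈ X.filter (fun b => dist z b ≤ 1), f b z ≤ sF * ((12 : ℝ) - ((X.filter fun q => dist z q = 1).card : ℝ))) :
    (T.card : ℝ) ≤ sF * ∑ z ∈ PAYW, ((12 : ℝ) - ((X.filter fun q => dist z q = 1).card : ℝ)) := by
  set deg : EuclideanSpace ℝ (Fin 3) → ℕ := fun z => (X.filter fun q => dist z q = 1).card with hdeg
  set df : EuclideanSpace ℝ (Fin 3) → ℝ := fun z => (12 : ℝ) - (deg z : ℝ) with hdf
  set Tb : EuclideanSpace ℝ (Fin 3) → ℕ := fun b => (T.filter fun bq => bq.1 = b).card with hTb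
  set N : EuclideanSpace ℝ (Fin 3) → Finset (EuclideanSpace ℝ (Fin 3)) :=
    fun b => X.filter (fun z' => dist b z' ≤ 1 ∧ deg z' ≤ 11) with hN
  set F : EuclideanSpace ℝ (Fin 3) → ℝ := fun b => ∑ z ∈ N b, f b z with hF
  -- scaled assignment `g b z = f b z · T_b / F b`
  set g : EuclideanSpace ℝ (Fin 3) → EuclideanSpace ℝ (Fin 3) → ℝ :=
    fun b z => if Tb b = 0 then 0 else f b z * (Tb b : ℝ) / F b with hg
  have hdf0 : ∀ z, deg z ≤ 11 → 0 ≤ df z := by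
    intro z hz; have : (deg z : ℝ) ≤ 11 := by exact_mod_cast hz
    show (0 : ℝ) ≤ 12 - (deg z : ℝ); linarith
  have hFpos : ∀ b ∈ X, Tb b ≠ 0 → 0 < F b := by
    intro b hb h0
    have h1 : (0 : ℝ) < (Tb b : ℝ) := by exact_mod_cast Nat.pos_of_ne_zero h0
    have h2 : (Tb b : ℝ) ≤ (endMult X v S₁ S₂ b : ℝ) := by exact_mod_cast hTle b hb
    exact lt_of_lt_of_le (lt_of_lt_of_le h1 h2) (hsupply b hb)
  have hg0 : ∀ b z, b ∈ X → 0 ≤ g b z := by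
    intro b z hb
    simp only [hg]
    split_ifs with h0
    · exact le_rfl
    · exact div_nonneg (mul_nonneg (hf0 b z) (Nat.cast_nonneg _)) (hFpos b hb h0).le
  have hgle : ∀ b z, b ∈ X → g b z ≤ f b z := by
    intro b z hb
    simp only [hg]
    split_ifs with h0
    · exact hf0 b z
    · have hFp := hFpos b hb h0
      have h2 : (Tb b : ℝ) ≤ F b := le_trans (by exact_mod_cast hTle b hb) (hsupply b hb)
      rw [div_le_iff₀ hFp]
      exact mul_le_mul_of_nonneg_left h2 (hf0 b z)
  -- (1) `#T = Σ_b T_b`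
  have h1 : (T.card : ℝ) = ∑ b ∈ X, (Tb b : ℝ) := by
    have := card_eq_sum_card_fiberwise (f := fun bq : EuclideanSpace ℝ (Fin 3) × EuclideanSpace ℝ (Fin 3) => bq.1)
      (s := T) (t := X) (fun bq hbq => hT bq hbq)
    rw [this]; push_cast; rfl
  -- (2) `T_b = Σ_{z ∈ N b} g b z`
  have h2 : ∀ b ∈ X, (Tb b : ℝ) = ∑ z ∈ N b, g b z := by
    intro b hb
    by_cases h0 : Tb b = 0
    · simp [hg, h0]
    · have hFp := hFpos b hb h0
      have e : ∑ z ∈ N b, g b z = (Tb b : ℝ) / F b * ∑ z ∈ N b, f b z := by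
        rw [mul_sum]; refine sum_congr rfl fun z _ => ?_; simp only [hg, if_neg h0]; ring
      rw [e]
      show (Tb b : ℝ) = (Tb b : ℝ) / F b * F b
      rw [div_mul_cancel₀ _ hFp.ne']
  -- (3) exchange sums
  set PAY := X.filter (fun z => deg z ≤ 11) with hPAY
  set M : EuclideanSpace ℝ (Fin 3) → Finset (EuclideanSpace ℝ (Fin 3)) := fun z => X.filter (fun b => dist z b ≤ 1) with hM
  have h3 : ∑ b ∈ X, ∑ z ∈ N b, g b z = ∑ z ∈ PAY, ∑ b ∈ M z, g b z := by
    refine sum_comm' ?_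
    intro b z
    constructor
    · rintro ⟨hb, hz⟩
      obtain ⟨hzX, hdz, hz11⟩ := mem_filter.1 hz
      exact ⟨mem_filter.2 ⟨hb, by rw [dist_comm]; exact hdz⟩, mem_filter.2 ⟨hzX, hz11⟩⟩
    · rintro ⟨hb, hz⟩
      obtain ⟨hzX, hz11⟩ := mem_filter.1 hz
      obtain ⟨hbX, hdz⟩ := mem_filter.1 hb
      exact ⟨hbX, mem_filter.2 ⟨hzX, by rw [dist_comm]; exact hdz, hz11⟩⟩
  -- (4) loads: `Σ_b g b z ≤ sF · df z` on `PAYW`, and `0` off `PAYW`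
  have h4 : ∀ z ∈ PAY, ∑ b ∈ M z, g b z ≤ (if z ∈ PAYW then sF * df z else 0) := by
    intro z hz
    obtain ⟨hzX, hz11⟩ := mem_filter.1 hz
    by_cases hzW : z ∈ PAYW
    · rw [if_pos hzW]
      calc ∑ b ∈ M z, g b z ≤ ∑ b ∈ M z, f b z := sum_le_sum fun b hb => hgle b z (mem_filter.1 hb).1
        _ ≤ sF * df z := hload z hzX hz11
    · rw [if_neg hzW]
      refine le_of_eq (sum_eq_zero fun b hb => ?_)
      obtain ⟨hbX, hd⟩ := mem_filter.1 hb
      simp only [hg]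
      split_ifs with h0
      · rfl
      · exfalso
        obtain ⟨bq, hbq⟩ := card_pos.1 (Nat.pos_of_ne_zero h0)
        obtain ⟨hbqT, hb1⟩ := mem_filter.1 hbq
        exact hzW (hclosed bq hbqT z hzX (by rw [hb1, dist_comm]; exact hd) hz11)
  -- (5) assemble
  have h5 : ∑ z ∈ PAY, (if z ∈ PAYW then sF * df z else 0) = sF * ∑ z ∈ PAYW, df z := by
    rw [← sum_filter]
    have hsub : PAY.filter (fun z => z ∈ PAYW) = PAYW := by
      ext z
      constructor
      · intro hz; exact (mem_filter.1 hz).2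
      · intro hz
        obtain ⟨hzX, hz11⟩ := hPAYW z hz
        exact mem_filter.2 ⟨mem_filter.2 ⟨hzX, hz11⟩, hz⟩
    rw [hsub, mul_sum]
  calc (T.card : ℝ) = ∑ b ∈ X, (Tb b : ℝ) := h1
    _ = ∑ b ∈ X, ∑ z ∈ N b, g b z := sum_congr rfl h2
    _ = ∑ z ∈ PAY, ∑ b ∈ M z, g b z := h3
    _ ≤ ∑ z ∈ PAY, (if z ∈ PAYW then sF * df z else 0) := sum_le_sum h4
    _ = sF * ∑ z ∈ PAYW, df z := h5

end Summit.Ventures.Crystal3D.Theorems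

end
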